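import Mathlib.Analysis.Matrix.Order
import Literature.MathematicalPhysics.QuantumLattice.SymbolCertificate
import HarnessLib

/-!
# Evaluation of function-field certificates: the per-`L` matrix certificate

Topic `MathematicalPhysics/QuantumLattice`; companion of `SymbolCertificate.lean` (definition
`TorusSymbolCertificate`, route `HubbardSuperconductivity/FunctionFieldCertificate`, support item
`SymbolEvaluation`). A function-field SOS + KKT certificate `c : TorusSymbolCertificate M deg p a`
is `L`-independent finite data whose `identity` field reads, on every even torus of side
`L ≥ c.L₀`,

  `M_L - a·1 = sosSum + kktSum + (H_L R_L - R_L H_L) + T_L + E_L`,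

with `sosSum = Σ_j Σ_κ s_j(κ) O_j(κ)ᴴ O_j(κ)`, `kktSum = Σ_m Σ_κ a_m(κ) Q_m(κ)ᴴ (H_L Q_m(κ) - Q_m(κ) H_L)`,
real weights `s_j, a_m ≥ 0`, sector-preserving `Q_m(κ)`, a sector-null `T_L` and a remainder with
`-C/L ≤ E_L ≤ C/L`. This file proves the SOUNDNESS OF THE FINITE PRESENTATION at each side `L`:
the evaluated certificate is a per-`L` semantic certificate (`MatrixCertificate M L (a - C/L)`,
the matrix data of the route's typed target `CertifiedSectorLRO`):

* `exists_sosSum_eq_sum` — the SOS channel is a finite sum `Σ_i O_iᴴ O_i` (absorb `√s_j(κ)` into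
  `O_j(κ)` and reindex the finitely many pairs `(j, κ)` by `Fin n`);
* `exists_kktSum_eq_sum` — the KKT channel is `Σ_i Q_iᴴ (H_L Q_i - Q_i H_L)` with every `Q_i`
  sector-preserving (absorb `√a_m(κ)`);
* `exists_matrix_identity` / `nonempty_matrixCertificate` / `exists_threshold` — the remainder is
  absorbed into the slack: `E_L + (C/L)·1` is positive semidefinite, hence `= Bᴴ B`
  (`CStarAlgebra.nonneg_iff_eq_star_mul_self` for the `C⋆`-order on matrices), so
  `M_L - (a - C/L)·1 = (Bᴴ B + Σ_i O_iᴴ O_i) + Σ_i Q_iᴴ [H_L, Q_i] + [H_L, R_L] + T_L`.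

Everything is finite-dimensional bookkeeping ([folklore]); the analytic content of a certificate
(rational identity, positivity of the weights, the `O(1/L)` Riemann-sum remainder) is in the
fields of `TorusSymbolCertificate`, not here. Not here either: the ground-state consequence of a
`MatrixCertificate` (route item `CertificateSoundness`) and any instance.
-/

noncomputable section

namespace Literature.MathematicalPhysics.QuantumLattice

open Matrix Finset Literature.Probability.LatticeModels
open scoped ComplexConjugate ComplexOrder

/-! ### Scalar bookkeeping: absorbing a nonnegative real weight into the operator -/

/-- For a complex number `s` that is real and nonnegative, `conj (√(re s)) · √(re s) = s`.
[folklore] -/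
theorem star_sqrt_re_mul_sqrt_re {s : ℂ} (hs : 0 ≤ s.re) (him : s.im = 0) :
    star ((Real.sqrt s.re : ℝ) : ℂ) * ((Real.sqrt s.re : ℝ) : ℂ) = s := by
  rw [Complex.star_def, Complex.conj_ofReal, ← Complex.ofReal_mul, Real.mul_self_sqrt hs]
  exact Complex.ext (by simp) (by simp [him])

/-- Absorbing a nonnegative real weight into an SOS generator:
`(√s · A)ᴴ (√s · A) = s · Aᴴ A`. [folklore] -/
theorem conjTranspose_sqrt_smul_mul_self {m k : Type*} [Fintype m] {s : ℂ} (hs : 0 ≤ s.re)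
    (him : s.im = 0) (A : Matrix m k ℂ) :
    (((Real.sqrt s.re : ℝ) : ℂ) • A)ᴴ * (((Real.sqrt s.re : ℝ) : ℂ) • A) = s • (Aᴴ * A) := by
  rw [conjTranspose_smul, Matrix.smul_mul, Matrix.mul_smul, smul_smul,
    star_sqrt_re_mul_sqrt_re hs him]

/-- Absorbing a nonnegative real weight into a KKT generator:
`(√a · Q)ᴴ (H (√a · Q) - (√a · Q) H) = a · Qᴴ (H Q - Q H)`. [folklore] -/
theorem conjTranspose_sqrt_smul_mul_comm {m : Type*} [Fintype m] {s : ℂ} (hs : 0 ≤ s.re)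
    (him : s.im = 0) (H Q : Matrix m m ℂ) :
    (((Real.sqrt s.re : ℝ) : ℂ) • Q)ᴴ *
        (H * (((Real.sqrt s.re : ℝ) : ℂ) • Q) - (((Real.sqrt s.re : ℝ) : ℂ) • Q) * H) =
      s • (Qᴴ * (H * Q - Q * H)) := by
  rw [Matrix.mul_smul, Matrix.smul_mul, ← smul_sub, conjTranspose_smul, Matrix.smul_mul,
    Matrix.mul_smul, smul_smul, star_sqrt_re_mul_sqrt_re hs him]

/-- Reindexing a finite family by `Fin n` (`Fintype.equivFin`): every finite sum `Σ_i P (O i)` is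
a sum over `Fin n` of the same terms, each new entry being one of the old ones. [folklore] -/
theorem exists_fin_reindex {ι α β : Type*} [Fintype ι] [AddCommMonoid β] (P : α → β) (O : ι → α) :
    ∃ (n : ℕ) (O' : Fin n → α), (∀ j, ∃ i, O' j = O i) ∧ ∑ j, P (O' j) = ∑ i, P (O i) :=
  ⟨Fintype.card ι, O ∘ (Fintype.equivFin ι).symm, fun _ => ⟨_, rfl⟩,
    Fintype.sum_equiv (Fintype.equivFin ι).symm _ _ fun _ => rfl⟩

/-! ### Flattening the SOS and KKT channels -/

section Channels

variable {d : ℕ} (M : MomentumModel d)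

/-- Prepending a pair adds its term to the KKT channel. [folklore] -/
@[simp] theorem kktSum_cons (F : WeightedSymbolOp M.Letter d) (l : List (WeightedSymbolOp M.Letter d))
    (L : ℕ) [NeZero L] :
    kktSum M (F :: l) L = (∑ κ : Fin F.arity → TorusSite d L,
      F.weight.eval L κ • ((F.op.eval M L κ)ᴴ *
        (M.ham L * F.op.eval M L κ - F.op.eval M L κ * M.ham L))) + kktSum M l L := by
  simp [kktSum]

/-- The SOS channel of the empty list is `0`. [folklore] -/
@[simp] theorem sosSum_nil (L : ℕ) [NeZero L] : sosSum M [] L = 0 := by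
  simp [sosSum]

/-- The KKT channel of the empty list is `0`. [folklore] -/
@[simp] theorem kktSum_nil (L : ℕ) [NeZero L] : kktSum M [] L = 0 := by
  simp [kktSum]

/-- **The SOS channel is a finite sum of hermitian squares.** If every weight of the list is real
and nonnegative at every grid point, then `sosSum M l L = Σ_{i < n} O_iᴴ O_i` for finitely many
matrices `O_i` (namely the `√s_j(κ) · O_j(κ)`, reindexed). [folklore] -/
theorem exists_sosSum_eq_sum (l : List (WeightedSymbolOp M.Letter d))
    (hl : ∀ F ∈ l, F.WeightNonneg) (L : ℕ) [NeZero L] :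
    ∃ (n : ℕ) (O : Fin n → Matrix (M.idx L) (M.idx L) ℂ), sosSum M l L = ∑ i, (O i)ᴴ * O i := by
  induction l with
  | nil => exact ⟨0, fun i => i.elim0, by simp⟩
  | cons F l ih =>
    obtain ⟨n, O, hO⟩ := ih fun G hG => hl G (List.mem_cons_of_mem F hG)
    have hF : F.WeightNonneg := hl F (by simp)
    -- the new generators `√s(κ) · O(κ)`, indexed by the grid momenta `κ`
    set O₁ : (Fin F.arity → TorusSite d L) → Matrix (M.idx L) (M.idx L) ℂ :=
      fun κ => ((Real.sqrt (F.weight.eval L κ).re : ℝ) : ℂ) • F.op.eval M L κ with hO₁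
    have h₁ : ∀ κ, (O₁ κ)ᴴ * O₁ κ =
        F.weight.eval L κ • ((F.op.eval M L κ)ᴴ * F.op.eval M L κ) := fun κ =>
      conjTranspose_sqrt_smul_mul_self (hF L κ).1 (hF L κ).2 _
    obtain ⟨n', O', -, hO'⟩ :=
      exists_fin_reindex (fun X : Matrix (M.idx L) (M.idx L) ℂ => Xᴴ * X) (Sum.elim O₁ O)
    refine ⟨n', O', ?_⟩
    rw [sosSum_cons, hO, hO', Fintype.sum_sum_type]
    simp only [Sum.elim_inl, Sum.elim_inr, h₁]

/-- **The KKT channel is a finite sum `Σ_i Q_iᴴ (H_L Q_i - Q_i H_L)` of sector-preserving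
generators.** If every weight of the list is real and nonnegative at every grid point and every
`Q_m(κ)` maps the sector into itself, then so do the finitely many `Q_i := √a_m(κ) · Q_m(κ)`
(reindexed), and `kktSum M l L = Σ_{i < m} Q_iᴴ (H_L Q_i - Q_i H_L)`. [folklore] -/
theorem exists_kktSum_eq_sum (l : List (WeightedSymbolOp M.Letter d))
    (hl : ∀ F ∈ l, F.WeightNonneg)
    (hs : ∀ F ∈ l, ∀ (L : ℕ) [NeZero L] (κ : Fin F.arity → TorusSite d L) (ψ : M.idx L → ℂ),
      ψ ∈ M.sector L → F.op.eval M L κ *ᵥ ψ ∈ M.sector L)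
    (L : ℕ) [NeZero L] :
    ∃ (m : ℕ) (Q : Fin m → Matrix (M.idx L) (M.idx L) ℂ),
      (∀ i (ψ : M.idx L → ℂ), ψ ∈ M.sector L → Q i *ᵥ ψ ∈ M.sector L) ∧
      kktSum M l L = ∑ i, (Q i)ᴴ * (M.ham L * Q i - Q i * M.ham L) := by
  induction l with
  | nil => exact ⟨0, fun i => i.elim0, fun i => i.elim0, by simp⟩
  | cons F l ih =>
    obtain ⟨n, Q, hQs, hQ⟩ := ih (fun G hG => hl G (List.mem_cons_of_mem F hG))
      (fun G hG => hs G (List.mem_cons_of_mem F hG))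
    have hF : F.WeightNonneg := hl F (by simp)
    have hFs := hs F (by simp) L
    -- the new generators `√a(κ) · Q(κ)`, indexed by the grid momenta `κ`
    set Q₁ : (Fin F.arity → TorusSite d L) → Matrix (M.idx L) (M.idx L) ℂ :=
      fun κ => ((Real.sqrt (F.weight.eval L κ).re : ℝ) : ℂ) • F.op.eval M L κ with hQ₁
    have h₁ : ∀ κ, (Q₁ κ)ᴴ * (M.ham L * Q₁ κ - Q₁ κ * M.ham L) =
        F.weight.eval L κ • ((F.op.eval M L κ)ᴴ *
          (M.ham L * F.op.eval M L κ - F.op.eval M L κ * M.ham L)) := fun κ =>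
      conjTranspose_sqrt_smul_mul_comm (hF L κ).1 (hF L κ).2 _ _
    have h₁s : ∀ κ (ψ : M.idx L → ℂ), ψ ∈ M.sector L → Q₁ κ *ᵥ ψ ∈ M.sector L := by
      intro κ ψ hψ
      rw [hQ₁, Matrix.smul_mulVec]
      exact Submodule.smul_mem _ _ (hFs κ ψ hψ)
    obtain ⟨m', Q', hQ'mem, hQ'⟩ :=
      exists_fin_reindex (fun X : Matrix (M.idx L) (M.idx L) ℂ => Xᴴ * (M.ham L * X - X * M.ham L))
        (Sum.elim Q₁ Q)
    refine ⟨m', Q', fun i ψ hψ => ?_, ?_⟩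
    · obtain ⟨j, hj⟩ := hQ'mem i
      rw [hj]
      cases j with
      | inl κ => exact h₁s κ ψ hψ
      | inr i' => exact hQs i' ψ hψ
    · rw [kktSum_cons, hQ, hQ', Fintype.sum_sum_type]
      simp only [Sum.elim_inl, Sum.elim_inr, h₁]

end Channels

/-! ### The evaluated certificate -/

namespace TorusSymbolCertificate

variable {d : ℕ} {M : MomentumModel d} {deg p : ℕ} {a : ℝ}

/-- **Soundness of the finite presentation at one side (the matrix identity).** A function-field
certificate `c` of `⟨M_L⟩ ≥ a - O(1/L)` yields, on every even torus of side `L ≥ c.L₀`, finitely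
many matrices `O_i`, sector-preserving `Q_i`, a matrix `R` and a sector-null `T` with
`M_L - (a - C/L)·1 = Σ_i O_iᴴ O_i + Σ_i Q_iᴴ (H_L Q_i - Q_i H_L) + (H_L R - R H_L) + T`
(`C = c.C`): flatten the SOS and KKT channels (`exists_sosSum_eq_sum`, `exists_kktSum_eq_sum`),
keep `R = R_L`, `T = T_L`, and absorb the remainder — `E_L + (C/L)·1 ⪰ 0` is a hermitian square
`Bᴴ B`, added to the SOS list. [folklore] -/
theorem exists_matrix_identity (c : TorusSymbolCertificate M deg p a) (L : ℕ) [NeZero L]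
    (hL : c.L₀ ≤ L) (hE : Even L) :
    ∃ (n m : ℕ) (O : Fin n → Matrix (M.idx L) (M.idx L) ℂ)
      (Q : Fin m → Matrix (M.idx L) (M.idx L) ℂ) (R T : Matrix (M.idx L) (M.idx L) ℂ),
      (∀ i (ψ : M.idx L → ℂ), ψ ∈ M.sector L → Q i *ᵥ ψ ∈ M.sector L) ∧
      (∀ ψ : M.idx L → ℂ, ψ ∈ M.sector L → star ψ ⬝ᵥ T *ᵥ ψ = 0) ∧
      M.order L - ((a - c.C / L : ℝ) : ℂ) • (1 : Matrix (M.idx L) (M.idx L) ℂ) =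
        ∑ i, (O i)ᴴ * O i + ∑ i, (Q i)ᴴ * (M.ham L * Q i - Q i * M.ham L) +
          (M.ham L * R - R * M.ham L) + T := by
  obtain ⟨n, O, hO⟩ := exists_sosSum_eq_sum M c.sos c.sos_nonneg L
  obtain ⟨m, Q, hQs, hQ⟩ := exists_kktSum_eq_sum M c.kkt c.kkt_nonneg c.kkt_sector L
  -- the remainder plus the slack is a hermitian square
  obtain ⟨B, hB⟩ : ∃ B : Matrix (M.idx L) (M.idx L) ℂ,
      c.error L + ((c.C / L : ℝ) : ℂ) • 1 = Bᴴ * B := by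
    open scoped MatrixOrder in
    obtain ⟨B, hB⟩ := CStarAlgebra.nonneg_iff_eq_star_mul_self.mp (c.error_lower L hL).nonneg
    exact ⟨B, hB⟩
  refine ⟨n + 1, m, Matrix.vecCons B O, Q, weightedSum M c.rch L, c.sectorTerm L, hQs,
    c.sectorTerm_null L, ?_⟩
  have hid := c.identity L hL hE
  rw [Fin.sum_univ_succ]
  simp only [Matrix.cons_val_zero, Matrix.cons_val_succ]
  rw [← hO, ← hQ, ← hB, Complex.ofReal_sub, sub_smul]
  calc M.order L - ((a : ℂ) • (1 : Matrix (M.idx L) (M.idx L) ℂ) - ((c.C / L : ℝ) : ℂ) • 1)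
      = (M.order L - (a : ℂ) • 1) + ((c.C / L : ℝ) : ℂ) • 1 := by abel
    _ = sosSum M c.sos L + kktSum M c.kkt L +
          (M.ham L * weightedSum M c.rch L - weightedSum M c.rch L * M.ham L) +
          c.sectorTerm L + c.error L + ((c.C / L : ℝ) : ℂ) • 1 := by rw [hid]
    _ = _ := by abel

/-- **Evaluation**: a function-field certificate of level `a` yields a per-`L` semantic
certificate `MatrixCertificate M L (a - C/L)` on every even torus of side `L ≥ L₀`. [folklore] -/
theorem nonempty_matrixCertificate (c : TorusSymbolCertificate M deg p a) (L : ℕ) [NeZero L]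
    (hL : c.L₀ ≤ L) (hE : Even L) : Nonempty (MatrixCertificate M L (a - c.C / L)) := by
  obtain ⟨n, m, O, Q, R, T, hQ, hT, hid⟩ := c.exists_matrix_identity L hL hE
  exact ⟨⟨n, m, O, Q, R, T, hQ, hT, hid⟩⟩

/-- **Evaluation, threshold form** (the shape of the route target `CertifiedSectorLRO` at the
certificate's own model and level): there are `C` and `L₀` such that on every even torus of side
`L ≥ L₀` the matrix identity of `exists_matrix_identity` holds with slack `a - C/L`. [folklore] -/
theorem exists_threshold (c : TorusSymbolCertificate M deg p a) :
    ∃ (C : ℝ) (L₀ : ℕ), ∀ (L : ℕ) [NeZero L], L₀ ≤ L → Even L →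
      ∃ (n m : ℕ) (O : Fin n → Matrix (M.idx L) (M.idx L) ℂ)
        (Q : Fin m → Matrix (M.idx L) (M.idx L) ℂ) (R T : Matrix (M.idx L) (M.idx L) ℂ),
        (∀ i (ψ : M.idx L → ℂ), ψ ∈ M.sector L → Q i *ᵥ ψ ∈ M.sector L) ∧
        (∀ ψ : M.idx L → ℂ, ψ ∈ M.sector L → star ψ ⬝ᵥ T *ᵥ ψ = 0) ∧
        M.order L - ((a - C / L : ℝ) : ℂ) • (1 : Matrix (M.idx L) (M.idx L) ℂ) =
          ∑ i, (O i)ᴴ * O i + ∑ i, (Q i)ᴴ * (M.ham L * Q i - Q i * M.ham L) +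
            (M.ham L * R - R * M.ham L) + T :=
  ⟨c.C, c.L₀, fun L _ hL hE => c.exists_matrix_identity L hL hE⟩

end TorusSymbolCertificate

end Literature.MathematicalPhysics.QuantumLattice

end
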